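/-
Copyright (c) 2026 the pub-hodgecm-mathlib formalisation cell (harness21).  Prover seat hodgecm-mathlib-LH3-p03 (g6): LH3 «Transf» road, letter L3′ surjective half,
brick (Σ4c-desc) (carve F0P3a-p04 (g25) 2026-09-02T12:57:32Z; consumer LH10-p02 (g7) (Σ4c-asm) `exists_classDescent_of_section_of_descent`).
-/
import Literature.NumberTheory.Rogawski1990.ArchBouazizClassMap     -- ★ p851469 (LH10-p01 (g5)): `bzClassMap`, `bzClassMap_of_mem ∕ _of_not_mem ∕ _congr`; brings ★ `ArchCartanCoordinates` (`RegS`, `angleShift`, `flipAt`, `negXAt`), ★ `ArchCartanNormalisers` (`archRH`)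
import Mathlib.Analysis.SpecialFunctions.Trigonometric.DerivHyp      -- `Real.cosh_le_cosh`
import HarnessLib

/-!
# (Σ4c-desc) DESCENT OF THE QUOTIENT `Ψ ∕ Φ` THROUGH THE STABLE-CLASS MAP ON ONE CHART: same class ⇒ same quotient (Bouaziz 1994 §2.3, §5.1; Shelstad 1979 §4 (II); Rogawski 1990 §3.6)

Topic `NumberTheory/Rogawski1990`; namespace `Literature.NumberTheory.Rogawski1990`.  THEOREMS ONLY (no `def`, no instance, no notation, no axiom, no named fact, no `sorry`);
GROUP-FREE (coordinates `c : W → Fin 3 → ℝ`, any `[Fintype W] [DecidableEq W]`).  Cell `pub/hodgecm-mathlib`, crux H413 (`stmt-HodgeConjecture-24833`), F0∕P3c line LH3 (closer stub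
`stub_N9`, leaf `F0_P3c_StubN9Direct`), letter L3′ `stub_N9bouazizSurjective`, v10 organ `BouazizSurjOfForwardStatement` (RULING #22), SURJ road (binder LH10-p01 (g5)) organ (Σ-REG)
(F0P3a-p04 (g25)), interface (Σ4c) `exists_classDescent` (LH10-p02 (g7), ★-cand `exists_classDescent_of_section_of_descent`), carve input **(Σ4c-desc)** — this file.

THE RESULT **`div_eq_div_of_bzClassMap_eq (S) (hΨP hΨW hΨX) (hΦP hΦW hΦX) (hc : c ∈ RegS S) (hc' : c' ∈ RegS S) (h : bzClassMap S c = bzClassMap S c') (hΦ : Φ c ≠ 0) :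
Φ c' ≠ 0 ∧ Ψ c ∕ Φ c = Ψ c' ∕ Φ c'`**: two functions `Ψ, Φ` on the chart `S` which are `2π`-PERIODIC in the angle slots (`hP`: `w ∉ S ∨ i ≠ 0`), transform under the FLIP at a compact
place by Shelstad's character (`hW`: `Ψ (flipAt w c) · R_S(c) = R_S(flipAt w c) · Ψ c`) and are EVEN under `x ↦ −x` at a split place (`hX`) — the chart-`S` projections of ★ `ArchBzPeriodic` ∕
`ArchBzWeyl` — have a quotient `Ψ ∕ Φ` that depends only on the STABLE CLASS `bzClassMap S c` (★ p851469: per place `(tr, det, U(1)-part)`), at regular points where `Φ ≠ 0`.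
PROOF.  PER PLACE, equal class data force the coordinates to be related by the chart symmetries: at a compact place `(e₀ + e₂, e₀e₂, e₁) = (e₀′ + e₂′, e₀′e₂′, e₁′)` gives
`{e₀, e₂} = {e₀′, e₂′}` (Vieta: `(e₀ − e₀′)(e₀ − e₂′) = 0`) and `e₁ = e₁′`, i.e. `c′_w` is `c_w` up to an optional flip `θ₀ ↔ θ₂` and `2π`-shifts (`Circle.exp_eq_exp`); at a split place
`((eˣ + e⁻ˣ)e^{iθ}, e^{2iθ}, e^{ic₁})` determines `cosh x` (take norms; `Real.cosh_le_cosh` ⇒ `|x| = |x′|`), hence `x′ = ±x`, then `e^{iθ} = e^{iθ′}` and `e^{ic₁} = e^{ic₁′}`, i.e. `c′_w` is `c_w`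
up to `negXAt` and shifts of the two angle slots.  Each move preserves `RegS` (★ `add_angleShift_mem_regS_iff`, `flipAt_mem_regS_iff`, `negXAt_mem_regS_iff`), leaves `Φ ≠ 0` and the
quotient unchanged (`hP`, `hX`; for the flip `R_S ≠ 0` on `RegS`, ★ `archRH_ne_zero_of_mem_regS`, so both `Ψ` and `Φ` pick up the SAME unit `R_S(flip c)∕R_S(c)`).  The places are
chained by `Finset.induction` on the hybrid point `mix T c c′ := (w ↦ if w ∈ T then c′ w else c w)` (class preserved by ★ `bzClassMap_congr`; `RegS` is place-wise).
HONEST LABEL: count-neutral; one carve input of (Σ4c); HC_CM is proved only modulo the 7 printed citations (2 remaining: hLiu418 = stmt-HodgeConjecture-24832, h413 =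
stmt-HodgeConjecture-24833) until rung 0 closes.

## References
* [Bouaziz1994IntegralesOrbitales] A. Bouaziz, *Intégrales orbitales sur les groupes de Lie réductifs*, Ann. Sci. ÉNS (4) 27 (1994) 573–609: §2.3 p. 578 (invariance under the stable
  Weyl group), §5.1 p. 588 (functions of the stable class).
* [Shelstad1979] D. Shelstad, *Characters and inner forms of a quasi-split group over ℝ*, Compositio Math. 39 (1979) 11–45: §4 (II) p. 23 (the flip character), p. 22 (regular set).
* [Rogawski1990] J. D. Rogawski, *Automorphic Representations of Unitary Groups in Three Variables*, Ann. of Math. Stud. 123 (1990), §3.6 p. 31 (stable conjugacy in `U(2)`, `U(1,1)`: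
  eigenvalue data), §8.2 p. 122.
-/

set_option autoImplicit false

noncomputable section

open Complex Set Function Real
open Literature.NumberTheory.Automorphic.ArchCartan

namespace Literature.NumberTheory.Rogawski1990

variable {W : Type*}

/-! ## §1 Per-place algebra: equal class data ⇒ coordinates related by the chart symmetries -/

section Algebra

/-- **VIETA FOR TWO ROOTS**: `a + b = a′ + b′` and `ab = a′b′` force `{a, b} = {a′, b′}` (from `(a − a′)(a − b′) = 0`; private twin of an elementary lemma that also
occurs in another summit's tree). [cite: Rogawski1990, §3.6 p. 31] -/
private theorem eq_or_swap_of_sum_eq_of_prod_eq {a b a' b' : ℂ} (h1 : a + b = a' + b') (h2 : a * b = a' * b') :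
    (a = a' ∧ b = b') ∨ (a = b' ∧ b = a') := by
  have h0 : (a - a') * (a - b') = 0 := by linear_combination a * h1 - h2
  rcases mul_eq_zero.1 h0 with h | h
  · left
    have ha : a = a' := sub_eq_zero.1 h
    exact ⟨ha, by linear_combination h1 - ha⟩
  · right
    have ha : a = b' := sub_eq_zero.1 h
    exact ⟨ha, by linear_combination h1 - ha⟩

/-- Equal circle points have angles differing by `2πk` (Mathlib `Circle.exp_eq_exp`, read on `ℂ`). [cite: Rogawski1990, §8.2 p. 122] -/
theorem exists_int_eq_add_of_coe_circleExp_eq {a b : ℝ} (h : (Circle.exp a : ℂ) = Circle.exp b) : ∃ k : ℤ, b = a + 2 * π * k := by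
  have h' : Circle.exp b = Circle.exp a := Circle.ext (by exact_mod_cast h.symm)
  obtain ⟨m, hm⟩ := Circle.exp_eq_exp.1 h'
  exact ⟨m, by rw [hm]; ring⟩

/-- **SPLIT PLACE**: `(eˣ + e⁻ˣ)·e^{iθ} = (e^{x′} + e^{−x′})·e^{iθ′}` forces `x′ = ±x` and `e^{iθ} = e^{iθ′}` (norms: `cosh x = cosh x′`; then cancel the positive scalar).
[cite: Rogawski1990, §3.6 p. 31] -/
theorem split_coords_of_classData_eq {x θ x' θ' : ℝ}
    (h : (((Real.exp x + Real.exp (-x) : ℝ)) : ℂ) * (Circle.exp θ : ℂ) = (((Real.exp x' + Real.exp (-x') : ℝ)) : ℂ) * (Circle.exp θ' : ℂ)) :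
    (x' = x ∨ x' = -x) ∧ (Circle.exp θ : ℂ) = Circle.exp θ' := by
  have hpos : 0 < Real.exp x + Real.exp (-x) := add_pos (Real.exp_pos _) (Real.exp_pos _)
  have hpos' : 0 < Real.exp x' + Real.exp (-x') := add_pos (Real.exp_pos _) (Real.exp_pos _)
  have hn := congrArg (fun z : ℂ => ‖z‖) h
  simp only [norm_mul, Complex.norm_real, Circle.norm_coe, mul_one, Real.norm_eq_abs, abs_of_pos hpos, abs_of_pos hpos'] at hn
  have hcosh : Real.cosh x = Real.cosh x' := by
    rw [Real.cosh_eq, Real.cosh_eq, hn]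
  have habs : |x'| = |x| := le_antisymm (Real.cosh_le_cosh.1 hcosh.symm.le) (Real.cosh_le_cosh.1 hcosh.le)
  refine ⟨abs_eq_abs.1 habs, ?_⟩
  rw [hn] at h
  exact mul_left_cancel₀ (by exact_mod_cast hpos'.ne') h

end Algebra

/-! ## §2 The moves as updates at one place -/

section Moves

variable [DecidableEq W]

/-- Three angle shifts at `w` realise any `2π`-congruent update at `w`. [cite: Shelstad1979, §4 p. 22] -/
theorem update_eq_add_angleShift_of_congr (c : W → Fin 3 → ℝ) (w : W) (v : Fin 3 → ℝ) (k₀ k₁ k₂ : ℤ)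
    (h0 : v 0 = c w 0 + 2 * π * k₀) (h1 : v 1 = c w 1 + 2 * π * k₁) (h2 : v 2 = c w 2 + 2 * π * k₂) :
    Function.update c w v = c + angleShift w 0 k₀ + angleShift w 1 k₁ + angleShift w 2 k₂ := by
  funext w' i
  by_cases hw : w' = w
  · subst hw
    simp only [Function.update_self, Pi.add_apply]
    fin_cases i
    · simp [angleShift_apply_self, angleShift_apply_self_of_ne, h0]
    · simp [angleShift_apply_self, angleShift_apply_self_of_ne, h1]
    · simp [angleShift_apply_self, angleShift_apply_self_of_ne, h2]
  · simp only [Function.update_of_ne hw, Pi.add_apply, angleShift_apply_of_ne hw, Pi.zero_apply, add_zero]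

/-- A flip at `w` followed by three angle shifts realises any update at `w` whose angles are `2π`-congruent to the SWAPPED pair. [cite: Shelstad1979, §4 p. 23] -/
theorem update_eq_flipAt_add_angleShift_of_congr (c : W → Fin 3 → ℝ) (w : W) (v : Fin 3 → ℝ) (k₀ k₁ k₂ : ℤ)
    (h0 : v 0 = c w 2 + 2 * π * k₀) (h1 : v 1 = c w 1 + 2 * π * k₁) (h2 : v 2 = c w 0 + 2 * π * k₂) :
    Function.update c w v = flipAt w c + angleShift w 0 k₀ + angleShift w 1 k₁ + angleShift w 2 k₂ := by
  funext w' i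
  by_cases hw : w' = w
  · subst hw
    simp only [Function.update_self, Pi.add_apply, flipAt_apply_self]
    fin_cases i
    · simp [angleShift_apply_self, angleShift_apply_self_of_ne, h0]
    · simp [angleShift_apply_self, angleShift_apply_self_of_ne, h1]
    · simp [angleShift_apply_self, angleShift_apply_self_of_ne, h2]
  · simp only [Function.update_of_ne hw, Pi.add_apply, flipAt_apply_of_ne hw, angleShift_apply_of_ne hw, Pi.zero_apply, add_zero]

/-- An optional sign change at `w` followed by two angle shifts realises any update at a SPLIT place with `x′ = ±x` and congruent angles. [cite: Shelstad1979, §4 p. 23] -/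
theorem update_eq_negXAt_add_angleShift_of_congr (c : W → Fin 3 → ℝ) (w : W) (v : Fin 3 → ℝ) (k₁ k₂ : ℤ)
    (h0 : v 0 = -c w 0) (h1 : v 1 = c w 1 + 2 * π * k₁) (h2 : v 2 = c w 2 + 2 * π * k₂) :
    Function.update c w v = negXAt w c + angleShift w 1 k₁ + angleShift w 2 k₂ := by
  funext w' i
  by_cases hw : w' = w
  · subst hw
    simp only [Function.update_self, Pi.add_apply, negXAt_apply_self]
    fin_cases i
    · simp [angleShift_apply_self_of_ne, h0]
    · simp [angleShift_apply_self, angleShift_apply_self_of_ne, h1]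
    · simp [angleShift_apply_self, angleShift_apply_self_of_ne, h2]
  · simp only [Function.update_of_ne hw, Pi.add_apply, negXAt_apply_of_ne hw, angleShift_apply_of_ne hw, Pi.zero_apply, add_zero]

/-- Two angle shifts (slots `1`, `2`) realise any update at `w` fixing `x` with congruent angles. [cite: Shelstad1979, §4 p. 22] -/
theorem update_eq_add_angleShift_of_congr₁₂ (c : W → Fin 3 → ℝ) (w : W) (v : Fin 3 → ℝ) (k₁ k₂ : ℤ)
    (h0 : v 0 = c w 0) (h1 : v 1 = c w 1 + 2 * π * k₁) (h2 : v 2 = c w 2 + 2 * π * k₂) :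
    Function.update c w v = c + angleShift w 1 k₁ + angleShift w 2 k₂ := by
  funext w' i
  by_cases hw : w' = w
  · subst hw
    simp only [Function.update_self, Pi.add_apply]
    fin_cases i
    · simp [angleShift_apply_self_of_ne, h0]
    · simp [angleShift_apply_self, angleShift_apply_self_of_ne, h1]
    · simp [angleShift_apply_self, angleShift_apply_self_of_ne, h2]
  · simp only [Function.update_of_ne hw, Pi.add_apply, angleShift_apply_of_ne hw, Pi.zero_apply, add_zero]

end Moves

/-! ## §3 Invariance of the quotient under each move -/

section Invariance

variable [Fintype W] [DecidableEq W] (S : Finset W) {Ψ Φ : (W → Fin 3 → ℝ) → ℂ}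

omit [Fintype W] in
/-- Under an admissible angle shift both families are unchanged, so are `Φ ≠ 0` and the quotient. [cite: Bouaziz1994IntegralesOrbitales, §2.3 p. 578] -/
theorem quot_invariant_angleShift
    (hΨP : ∀ (c : W → Fin 3 → ℝ) (w : W) (i : Fin 3) (k : ℤ), (w ∉ S ∨ i ≠ 0) → Ψ (c + angleShift w i k) = Ψ c)
    (hΦP : ∀ (c : W → Fin 3 → ℝ) (w : W) (i : Fin 3) (k : ℤ), (w ∉ S ∨ i ≠ 0) → Φ (c + angleShift w i k) = Φ c)
    {c : W → Fin 3 → ℝ} {w : W} {i : Fin 3} (hwi : w ∉ S ∨ i ≠ 0) (k : ℤ) (hΦ : Φ c ≠ 0) :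
    Φ (c + angleShift w i k) ≠ 0 ∧ Ψ c / Φ c = Ψ (c + angleShift w i k) / Φ (c + angleShift w i k) := by
  rw [hΨP c w i k hwi, hΦP c w i k hwi]
  exact ⟨hΦ, rfl⟩

omit [Fintype W] in
/-- Under the sign change at a split place both families are unchanged. [cite: Shelstad1979, §4 p. 23] -/
theorem quot_invariant_negXAt
    (hΨX : ∀ (c : W → Fin 3 → ℝ) (w : W), w ∈ S → Ψ (negXAt w c) = Ψ c)
    (hΦX : ∀ (c : W → Fin 3 → ℝ) (w : W), w ∈ S → Φ (negXAt w c) = Φ c)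
    {c : W → Fin 3 → ℝ} {w : W} (hw : w ∈ S) (hΦ : Φ c ≠ 0) :
    Φ (negXAt w c) ≠ 0 ∧ Ψ c / Φ c = Ψ (negXAt w c) / Φ (negXAt w c) := by
  rw [hΨX c w hw, hΦX c w hw]
  exact ⟨hΦ, rfl⟩

/-- **Under the FLIP at a compact place** both families pick up the SAME unit `R_S(flip c) ∕ R_S(c)` (`R_S ≠ 0` on `RegS`, ★ `archRH_ne_zero_of_mem_regS`), so `Φ ≠ 0` persists and the
quotient is unchanged. [cite: Shelstad1979, §4 (II) p. 23] -/
theorem quot_invariant_flipAt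
    (hΨW : ∀ (c : W → Fin 3 → ℝ) (w : W), w ∉ S → Ψ (flipAt w c) * archRH S c = archRH S (flipAt w c) * Ψ c)
    (hΦW : ∀ (c : W → Fin 3 → ℝ) (w : W), w ∉ S → Φ (flipAt w c) * archRH S c = archRH S (flipAt w c) * Φ c)
    {c : W → Fin 3 → ℝ} {w : W} (hw : w ∉ S) (hc : c ∈ RegS S) (hΦ : Φ c ≠ 0) :
    Φ (flipAt w c) ≠ 0 ∧ Ψ c / Φ c = Ψ (flipAt w c) / Φ (flipAt w c) := by
  have hR : archRH S c ≠ 0 := archRH_ne_zero_of_mem_regS hc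
  have hR' : archRH S (flipAt w c) ≠ 0 := archRH_ne_zero_of_mem_regS ((flipAt_mem_regS_iff S hw c).2 hc)
  have hΨ' : Ψ (flipAt w c) = archRH S (flipAt w c) * Ψ c / archRH S c := by
    rw [eq_div_iff hR]; exact hΨW c w hw
  have hΦ' : Φ (flipAt w c) = archRH S (flipAt w c) * Φ c / archRH S c := by
    rw [eq_div_iff hR]; exact hΦW c w hw
  have hΦne : Φ (flipAt w c) ≠ 0 := by
    rw [hΦ']; exact div_ne_zero (mul_ne_zero hR' hΦ) hR
  refine ⟨hΦne, ?_⟩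
  rw [hΨ', hΦ']
  field_simp

end Invariance

/-! ## §4 The one-place step and the head -/

section Descent

variable [Fintype W] [DecidableEq W] (S : Finset W) {Ψ Φ : (W → Fin 3 → ℝ) → ℂ}

/-- **ONE-PLACE STEP**: if `c` and its update `update c w v` are regular, have the same class data at `w`, and `Φ c ≠ 0`, then `Φ (update c w v) ≠ 0` and the quotient agrees — the
update is a composite of admissible moves at `w` (§1–§2), each preserving the quotient (§3). [cite: Bouaziz1994IntegralesOrbitales, §5.1 p. 588] [cite: Shelstad1979, §4 p. 23] -/
theorem div_eq_div_update_of_bzClassMap_apply_eq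
    (hΨP : ∀ (c : W → Fin 3 → ℝ) (w : W) (i : Fin 3) (k : ℤ), (w ∉ S ∨ i ≠ 0) → Ψ (c + angleShift w i k) = Ψ c)
    (hΨW : ∀ (c : W → Fin 3 → ℝ) (w : W), w ∉ S → Ψ (flipAt w c) * archRH S c = archRH S (flipAt w c) * Ψ c)
    (hΨX : ∀ (c : W → Fin 3 → ℝ) (w : W), w ∈ S → Ψ (negXAt w c) = Ψ c)
    (hΦP : ∀ (c : W → Fin 3 → ℝ) (w : W) (i : Fin 3) (k : ℤ), (w ∉ S ∨ i ≠ 0) → Φ (c + angleShift w i k) = Φ c)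
    (hΦW : ∀ (c : W → Fin 3 → ℝ) (w : W), w ∉ S → Φ (flipAt w c) * archRH S c = archRH S (flipAt w c) * Φ c)
    (hΦX : ∀ (c : W → Fin 3 → ℝ) (w : W), w ∈ S → Φ (negXAt w c) = Φ c)
    {c : W → Fin 3 → ℝ} (w : W) (v : Fin 3 → ℝ) (hc : c ∈ RegS S)
    (hw : bzClassMap S c w = bzClassMap S (Function.update c w v) w) (hΦ : Φ c ≠ 0) :
    Φ (Function.update c w v) ≠ 0 ∧ Ψ c / Φ c = Ψ (Function.update c w v) / Φ (Function.update c w v) := by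
  by_cases hwS : w ∈ S
  · -- SPLIT place: `x′ = ±x`, angles congruent
    rw [bzClassMap_of_mem hwS, bzClassMap_of_mem hwS] at hw
    simp only [Function.update_self, Prod.mk.injEq] at hw
    obtain ⟨h02, -, h1⟩ := hw
    obtain ⟨hx, hθ⟩ := split_coords_of_classData_eq h02
    obtain ⟨k₂, hk₂⟩ := exists_int_eq_add_of_coe_circleExp_eq hθ
    obtain ⟨k₁, hk₁⟩ := exists_int_eq_add_of_coe_circleExp_eq h1
    rcases hx with hx | hx
    · rw [update_eq_add_angleShift_of_congr₁₂ c w v k₁ k₂ hx hk₁ hk₂]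
      obtain ⟨h1Φ, h1q⟩ := quot_invariant_angleShift S hΨP hΦP (c := c) (w := w) (i := 1) (Or.inr (by decide)) k₁ hΦ
      obtain ⟨h2Φ, h2q⟩ := quot_invariant_angleShift S hΨP hΦP (c := c + angleShift w 1 k₁) (w := w) (i := 2) (Or.inr (by decide)) k₂ h1Φ
      exact ⟨h2Φ, h1q.trans h2q⟩
    · rw [update_eq_negXAt_add_angleShift_of_congr c w v k₁ k₂ hx hk₁ hk₂]
      obtain ⟨h0Φ, h0q⟩ := quot_invariant_negXAt S hΨX hΦX (c := c) hwS hΦ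
      obtain ⟨h1Φ, h1q⟩ := quot_invariant_angleShift S hΨP hΦP (c := negXAt w c) (w := w) (i := 1) (Or.inr (by decide)) k₁ h0Φ
      obtain ⟨h2Φ, h2q⟩ := quot_invariant_angleShift S hΨP hΦP (c := negXAt w c + angleShift w 1 k₁) (w := w) (i := 2) (Or.inr (by decide)) k₂ h1Φ
      exact ⟨h2Φ, h0q.trans (h1q.trans h2q)⟩
  · -- COMPACT place: `{e₀, e₂} = {e₀′, e₂′}`, `e₁ = e₁′`
    rw [bzClassMap_of_not_mem hwS, bzClassMap_of_not_mem hwS] at hw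
    simp only [Function.update_self, Prod.mk.injEq] at hw
    obtain ⟨hsum, hprod, h1⟩ := hw
    obtain ⟨k₁, hk₁⟩ := exists_int_eq_add_of_coe_circleExp_eq h1
    rcases eq_or_swap_of_sum_eq_of_prod_eq hsum hprod with ⟨ha, hb⟩ | ⟨ha, hb⟩
    · obtain ⟨k₀, hk₀⟩ := exists_int_eq_add_of_coe_circleExp_eq ha
      obtain ⟨k₂, hk₂⟩ := exists_int_eq_add_of_coe_circleExp_eq hb
      rw [update_eq_add_angleShift_of_congr c w v k₀ k₁ k₂ hk₀ hk₁ hk₂]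
      obtain ⟨h0Φ, h0q⟩ := quot_invariant_angleShift S hΨP hΦP (c := c) (w := w) (i := 0) (Or.inl hwS) k₀ hΦ
      obtain ⟨h1Φ, h1q⟩ := quot_invariant_angleShift S hΨP hΦP (c := c + angleShift w 0 k₀) (w := w) (i := 1) (Or.inl hwS) k₁ h0Φ
      obtain ⟨h2Φ, h2q⟩ := quot_invariant_angleShift S hΨP hΦP (c := c + angleShift w 0 k₀ + angleShift w 1 k₁) (w := w) (i := 2) (Or.inl hwS) k₂ h1Φ
      exact ⟨h2Φ, h0q.trans (h1q.trans h2q)⟩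
    · -- `e₀′ = e₂`, `e₂′ = e₀`: flip first
      obtain ⟨k₀, hk₀⟩ := exists_int_eq_add_of_coe_circleExp_eq hb   -- hb : e₂ = e₀′  ⇒ v 0 = c w 2 + 2πk₀
      obtain ⟨k₂, hk₂⟩ := exists_int_eq_add_of_coe_circleExp_eq ha   -- ha : e₀ = e₂′  ⇒ v 2 = c w 0 + 2πk₂
      rw [update_eq_flipAt_add_angleShift_of_congr c w v k₀ k₁ k₂ hk₀ hk₁ hk₂]
      obtain ⟨hfΦ, hfq⟩ := quot_invariant_flipAt S hΨW hΦW hwS hc hΦ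
      obtain ⟨h0Φ, h0q⟩ := quot_invariant_angleShift S hΨP hΦP (c := flipAt w c) (w := w) (i := 0) (Or.inl hwS) k₀ hfΦ
      obtain ⟨h1Φ, h1q⟩ := quot_invariant_angleShift S hΨP hΦP (c := flipAt w c + angleShift w 0 k₀) (w := w) (i := 1) (Or.inl hwS) k₁ h0Φ
      obtain ⟨h2Φ, h2q⟩ := quot_invariant_angleShift S hΨP hΦP (c := flipAt w c + angleShift w 0 k₀ + angleShift w 1 k₁) (w := w) (i := 2) (Or.inl hwS) k₂ h1Φ
      exact ⟨h2Φ, hfq.trans (h0q.trans (h1q.trans h2q))⟩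

/-- **(Σ4c-desc) SAME STABLE CLASS ⇒ SAME QUOTIENT `Ψ ∕ Φ`** (carve F0P3a-p04 (g25), the `hdesc` input of ★-cand (Σ4c-asm) `exists_classDescent_of_section_of_descent`): for `Ψ, Φ`
`2π`-periodic in the angle slots, FLIP-equivariant with Shelstad's character `R_S(flip c)∕R_S(c)` at the compact places and EVEN at the split places, and regular chart points
`c, c′ ∈ RegS S` with `bzClassMap S c = bzClassMap S c′` and `Φ c ≠ 0`: `Φ c′ ≠ 0` and `Ψ c ∕ Φ c = Ψ c′ ∕ Φ c′` (place-by-place chaining of the one-place step along the hybrid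
points `w ↦ if w ∈ T then c′ w else c w`, all regular). [cite: Bouaziz1994IntegralesOrbitales, §2.3 p. 578; §5.1 p. 588] [cite: Shelstad1979, §4 (II) p. 23] [cite: Rogawski1990, §3.6 p. 31] -/
theorem div_eq_div_of_bzClassMap_eq
    (hΨP : ∀ (c : W → Fin 3 → ℝ) (w : W) (i : Fin 3) (k : ℤ), (w ∉ S ∨ i ≠ 0) → Ψ (c + angleShift w i k) = Ψ c)
    (hΨW : ∀ (c : W → Fin 3 → ℝ) (w : W), w ∉ S → Ψ (flipAt w c) * archRH S c = archRH S (flipAt w c) * Ψ c)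
    (hΨX : ∀ (c : W → Fin 3 → ℝ) (w : W), w ∈ S → Ψ (negXAt w c) = Ψ c)
    (hΦP : ∀ (c : W → Fin 3 → ℝ) (w : W) (i : Fin 3) (k : ℤ), (w ∉ S ∨ i ≠ 0) → Φ (c + angleShift w i k) = Φ c)
    (hΦW : ∀ (c : W → Fin 3 → ℝ) (w : W), w ∉ S → Φ (flipAt w c) * archRH S c = archRH S (flipAt w c) * Φ c)
    (hΦX : ∀ (c : W → Fin 3 → ℝ) (w : W), w ∈ S → Φ (negXAt w c) = Φ c)
    {c c' : W → Fin 3 → ℝ} (hc : c ∈ RegS S) (hc' : c' ∈ RegS S) (h : bzClassMap S c = bzClassMap S c') (hΦ : Φ c ≠ 0) :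
    Φ c' ≠ 0 ∧ Ψ c / Φ c = Ψ c' / Φ c' := by
  -- the hybrid points are all regular (`RegS` is place-wise)
  have hmix : ∀ T : Finset W, (fun w => if w ∈ T then c' w else c w) ∈ RegS S := by
    intro T
    refine ⟨fun w hw => ?_, fun w hw => ?_⟩
    · by_cases hT : w ∈ T
      · simp only [hT, if_true]; exact hc'.1 w hw
      · simp only [hT, if_false]; exact hc.1 w hw
    · by_cases hT : w ∈ T
      · simp only [hT, if_true]; exact hc'.2 w hw
      · simp only [hT, if_false]; exact hc.2 w hw
  -- induction over the places
  have key : ∀ T : Finset W, Φ (fun w => if w ∈ T then c' w else c w) ≠ 0 ∧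
      Ψ c / Φ c = Ψ (fun w => if w ∈ T then c' w else c w) / Φ (fun w => if w ∈ T then c' w else c w) := by
    intro T
    induction T using Finset.induction_on with
    | empty =>
      have h0 : (fun w => if w ∈ (∅ : Finset W) then c' w else c w) = c := funext fun w => by simp
      rw [h0]
      exact ⟨hΦ, rfl⟩
    | insert w₁ T hw₁ ih =>
      obtain ⟨ihΦ, ihq⟩ := ih
      -- the next hybrid point is the update of the previous one at `w₁`
      have hupd : (fun w => if w ∈ insert w₁ T then c' w else c w) = Function.update (fun w => if w ∈ T then c' w else c w) w₁ (c' w₁) := by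
        funext w
        by_cases hw : w = w₁
        · subst hw; simp
        · simp [Finset.mem_insert, hw]
      have hcl : bzClassMap S (fun w => if w ∈ T then c' w else c w) w₁ =
          bzClassMap S (Function.update (fun w => if w ∈ T then c' w else c w) w₁ (c' w₁)) w₁ := by
        rw [bzClassMap_congr S (c' := c) (show (fun w => if w ∈ T then c' w else c w) w₁ = c w₁ by simp [hw₁]),
          bzClassMap_congr S (c' := c') (show Function.update (fun w => if w ∈ T then c' w else c w) w₁ (c' w₁) w₁ = c' w₁ by simp)]
        exact congrFun h w₁
      rw [hupd]
      obtain ⟨hΦ', hq'⟩ := div_eq_div_update_of_bzClassMap_apply_eq S hΨP hΨW hΨX hΦP hΦW hΦX w₁ (c' w₁) (hmix T) hcl ihΦ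
      exact ⟨hΦ', ihq.trans hq'⟩
  have hfin : (fun w => if w ∈ (Finset.univ : Finset W) then c' w else c w) = c' := funext fun w => by simp
  simpa only [hfin] using key Finset.univ

end Descent

end Literature.NumberTheory.Rogawski1990

end
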